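import Mathlib.Topology.MetricSpace.HolderNorm
import Literature.Probability.RandomPlanarGeometry.SLEHolderDomains
import Literature.Probability.RandomPlanarGeometry.LoewnerGrowth
import Literature.Probability.RandomPlanarGeometry.SLEHolderContinuity
import HarnessLib

/-!
# Hölder domains from Hölder continuity of `fₜ` (Rohde–Schramm 2005, (5.1) and proof of Cor. 5.3)

S. Rohde, O. Schramm, *Basic properties of SLE*, Ann. of Math. 161 (2005) 883–924
[RohdeSchramm2005] (= arXiv:math/0106036, held; there Thm 11, display (5.1), Cor 12), p. 12 of the
arXiv text, read verbatim:

> "Since `fₜ(z) - z → 0` as `z → ∞`, it easily follows that for every `t` a.s.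
> `|f̂ₜ(z) - f̂ₜ(z')| ≤ C(ω, t) max(|z - z'|, |z - z'|^{h(κ)})`. (5.1)"
> … "Proof [of Cor. 12 = Cor. 5.3]. … Consider the conformal map `T(z) = (z - i)/(z + i)` from
> `ℍ` onto `𝕌`. By (5.1), `T ∘ fₜ ∘ T⁻¹` is a.s. Hölder continuous in `𝕌`."

This file PROVES this passage as a deterministic statement about the chordal Loewner chain of an
arbitrary continuous driving function `W` (`Loewner.isHolderDomain_image_cayleyFun_domain`): if
`fₜ = gₜ⁻¹ = Loewner.loewnerInv W t` is Hölder continuous with some exponent `h > 0` on every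
bounded subset of `ℍₒ`, then the Cayley image `T(Hₜ)` of the Loewner domain `Hₜ = ℍₒ ∖ Kₜ` is a
Hölder domain (`IsHolderDomain`, `ConformalRemovability.lean`), the Hölder conformal equivalence
`𝔻 → T(Hₜ)` being `T ∘ fₜ ∘ T⁻¹` (exponent `min h 1`), and deduces the named fact
`RohdeSchramm2005_isHolderDomain_cayley_domain` from `RohdeSchramm2005_thm52` (Thm 5.2, Hölder
continuity of `f̂ₜ` on bounded sets) — `RohdeSchramm2005_isHolderDomain_cayley_domain_of_thm52` —
and, Thm 5.2 being proved in the tree (`RohdeSchramm2005_thm52_holds`, `SLEHolderContinuity.lean`),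
discharges it: `RohdeSchramm2005_isHolderDomain_cayley_domain_holds`.

## The proof

For `w, w'` in the unit disc write `z = T⁻¹ w`, `ζ = fₜ z` (and primes). The two identities
`T z - T z' = 2i (z - z')/((z + i)(z' + i))`, `1 - T z = 2i/(z + i)` give
`|T ζ - T ζ'| = 2|ζ - ζ'|/(|ζ + i| |ζ' + i|)` and `|z - z'| = |w - w'| |z + i| |z' + i|/2`.

* **Far field** (`|1 - w|, |1 - w'| ≤ ρ`, i.e. `|z + i|, |z' + i| ≥ 2/ρ` large). Where the paper
  says "since `fₜ(z) - z → 0` … it easily follows", we use the tree's quantitative far-field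
  theory of the BACKWARD Loewner flow (`LoewnerGrowth`, `LoewnerInverse`; Lawler (2005),
  Lemma 4.13 and eq. (4.7)): far from the driver the backward trajectories stay `δ`-away from it
  (`Loewner.le_norm_bwd_sub_driving_of_far`), where the field `-2/(z - W)` is `2/δ²`-Lipschitz,
  so by Grönwall `fₜ` is `e^{2t/δ²}`-LIPSCHITZ on the far field
  (`Loewner.dist_loewnerInv_le_of_far`)
  and moves points by `< 1` (`norm_invFunOn_map_sub_self_le`), whence `|ζ + i| ≥ |z + i|/2` and
  `|T ζ - T ζ'| ≤ 4 e^{2t/δ²} |w - w'|`.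
* **Bounded part** (`|1 - w|, |1 - w'| ≥ ρ/2`, i.e. `|z|, |z'| ≤ R₁`): the Hölder hypothesis and
  `|ζ + i| ≥ 1`.
* **Mixed pairs** are `ρ/2`-separated while `|T ζ - T ζ'| ≤ 2`.

The exponent is first lowered to `min h 1` (Mathlib `HolderOnWith.exists_holderOnWith_of_le`).
The probabilistic wrapper only intersects the full-measure events of Thm 5.2 over the countably
many bounded sets `ℍₒ ∩ B̄(0, n)`, `n ∈ ℕ`, and translates by `W t` (`f̂ₜ(z) = fₜ(z + W t)`).

## References

* [RohdeSchramm2005] S. Rohde, O. Schramm, Ann. of Math. 161 (2005), Thm 5.2, (5.1), Cor 5.3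
  (arXiv:math/0106036: Thm 11, (5.1), Cor 12, p. 12).
* [Lawler2005] G. F. Lawler, *Conformally Invariant Processes in the Plane*, AMS (2005), Ch. 4
  §4.1, Lemma 4.13, Thm 4.6 (eq. (4.7)).
* [JonesSmirnov2000] P. W. Jones, S. K. Smirnov, Ark. Mat. 38 (2000), p. 266 (Hölder domains).
-/

noncomputable section

open Set Filter Topology Metric Complex MeasureTheory
open UpperHalfPlane (upperHalfPlaneSet isOpen_upperHalfPlaneSet)
open scoped NNReal ENNReal

namespace Literature.Probability.RandomPlanarGeometry

/-! ### Two identities for the Cayley transform -/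

/-- `T z - T z' = 2i (z - z') / ((z + i)(z' + i))` for the Cayley transform `T`. [folklore] -/
theorem cayleyFun_sub_cayleyFun_of_ne {z z' : ℂ} (hz : z + I ≠ 0) (hz' : z' + I ≠ 0) :
    cayleyFun z - cayleyFun z' = 2 * I * (z - z') / ((z + I) * (z' + I)) := by
  rw [cayleyFun_apply, cayleyFun_apply, div_sub_div _ _ hz hz']
  ring

/-- `|T z - T z'| = 2 |z - z'| / (|z + i| |z' + i|)`. [folklore] -/
theorem norm_cayleyFun_sub_cayleyFun_of_ne {z z' : ℂ} (hz : z + I ≠ 0) (hz' : z' + I ≠ 0) :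
    ‖cayleyFun z - cayleyFun z'‖ = 2 * ‖z - z'‖ / (‖z + I‖ * ‖z' + I‖) := by
  rw [cayleyFun_sub_cayleyFun_of_ne hz hz', norm_div, norm_mul, norm_mul, norm_mul,
    Complex.norm_two, Complex.norm_I, mul_one]

/-- `1 - T z = 2i / (z + i)`: the Cayley transform near infinity. [folklore] -/
theorem one_sub_cayleyFun {z : ℂ} (hz : z + I ≠ 0) : 1 - cayleyFun z = 2 * I / (z + I) := by
  rw [cayleyFun_apply, eq_div_iff hz, sub_mul, div_mul_cancel₀ _ hz]
  ring

/-- `|1 - T z| = 2 / |z + i|`. [folklore] -/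
theorem norm_one_sub_cayleyFun {z : ℂ} (hz : z + I ≠ 0) : ‖1 - cayleyFun z‖ = 2 / ‖z + I‖ := by
  rw [one_sub_cayleyFun hz, norm_div, norm_mul, Complex.norm_two, Complex.norm_I, mul_one]

/-- **The Cayley transform restricted to a subset `D ⊆ ℍₒ`** is a conformal equivalence of `D`
onto `T(D)` (acting as `cayleyFun`, inverse `cayleyInvFun`). [folklore] -/
theorem exists_conformalEquiv_image_cayleyFun {D : Set ℂ} (hD : D ⊆ upperHalfPlaneSet) :
    ∃ ψ : ConformalEquiv D (cayleyFun '' D),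
      (∀ z, ψ z = cayleyFun z) ∧ ∀ w, ψ.symm w = cayleyInvFun w := by
  have hI : ∀ z ∈ D, z + I ≠ 0 := fun z hz ↦ add_I_ne_zero (le_of_lt (hD hz))
  have h1 : ∀ z ∈ D, cayleyFun z ≠ 1 := fun z hz h ↦ by
    have := (norm_cayleyFun_lt_one_iff (hI z hz)).2 (hD hz)
    rw [h, norm_one] at this
    exact lt_irrefl _ this
  refine ⟨{ toFun := cayleyFun
            invFun := cayleyInvFun
            source := D
            target := cayleyFun '' D
            map_source' := fun z hz ↦ mem_image_of_mem _ hz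
            map_target' := ?_
            left_inv' := fun z hz ↦ cayleyInvFun_cayleyFun (hI z hz)
            right_inv' := ?_
            source_eq := rfl
            target_eq := rfl
            differentiableOn := differentiableOn_cayleyFun.mono hI
            differentiableOn_symm := differentiableOn_cayleyInvFun.mono ?_ }, fun z ↦ rfl,
    fun w ↦ rfl⟩
  · rintro _ ⟨z, hz, rfl⟩
    show cayleyInvFun (cayleyFun z) ∈ D
    rwa [cayleyInvFun_cayleyFun (hI z hz)]
  · rintro _ ⟨z, hz, rfl⟩
    show cayleyFun (cayleyInvFun (cayleyFun z)) = cayleyFun z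
    rw [cayleyInvFun_cayleyFun (hI z hz)]
  · rintro _ ⟨z, hz, rfl⟩
    exact h1 z hz

/-! ### Elementary inequalities -/

/-- For `0 ≤ x ≤ 2` and `0 < h ≤ 1`: `x ≤ 2 x^h`. [folklore] -/
private theorem le_two_mul_rpow {x h : ℝ} (hx0 : 0 ≤ x) (hx2 : x ≤ 2) (hh0 : 0 < h)
    (hh1 : h ≤ 1) : x ≤ 2 * x ^ h := by
  rcases hx0.eq_or_lt with h0 | hx
  · rw [← h0, Real.zero_rpow hh0.ne', mul_zero]
  · have h1 : x = x ^ h * x ^ (1 - h) := by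
      rw [← Real.rpow_add hx, show h + (1 - h) = 1 by ring, Real.rpow_one]
    have h2 : x ^ (1 - h) ≤ 2 :=
      calc x ^ (1 - h) ≤ 2 ^ (1 - h) := Real.rpow_le_rpow hx0 hx2 (by linarith)
        _ ≤ 2 ^ (1 : ℝ) := Real.rpow_le_rpow_of_exponent_le one_le_two (by linarith)
        _ = 2 := Real.rpow_one 2
    calc x = x ^ h * x ^ (1 - h) := h1
      _ ≤ x ^ h * 2 := mul_le_mul_of_nonneg_left h2 (Real.rpow_nonneg hx0 h)
      _ = 2 * x ^ h := mul_comm _ _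

/-- A `dist`-form constructor for `HolderOnWith` between subsets of `ℂ`. [folklore] -/
private theorem holderOnWith_of_dist_le {f : ℂ → ℂ} {s : Set ℂ} {C : ℝ} {r : ℝ≥0} (hC : 0 ≤ C)
    (h : ∀ x ∈ s, ∀ y ∈ s, dist (f x) (f y) ≤ C * dist x y ^ (r : ℝ)) :
    HolderOnWith C.toNNReal r f s := by
  intro x hx y hy
  rw [edist_dist, edist_dist, ENNReal.ofReal_rpow_of_nonneg dist_nonneg r.coe_nonneg,
    ← ENNReal.ofReal_coe_nnreal, Real.coe_toNNReal C hC, ← ENNReal.ofReal_mul hC]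
  exact ENNReal.ofReal_le_ofReal (h x hx y hy)

namespace Loewner

variable {W : ℝ≥0 → ℝ}

/-! ### The far field of the backward flow: `fₜ` is Lipschitz near infinity -/

/-- **Far backward trajectories stay away from the driver**: if `|W u - c| ≤ M` on `[0, t]`,
`δ > 0`, `4t ≤ δ²` and `w ∈ ℍₒ` with `|w - c| ≥ M + 2δ`, then the backward flow
`u ↦ g_{t-u}(fₜ w)` stays `δ`-away from `W(t - u)` on `[0, t]` (the bootstrap
`le_norm_sub_of_far_aux` for the time-reversed equation, as in `norm_invFunOn_map_sub_self_le`).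
[cite: Lawler2005, Lemma 4.13] -/
theorem le_norm_bwd_sub_driving_of_far (hW : Continuous W) {t : ℝ≥0} {c : ℂ} {M δ : ℝ}
    (hM : ∀ u ∈ Icc (0 : ℝ) t, ‖(W u.toNNReal : ℂ) - c‖ ≤ M) (hδ : 0 < δ)
    (hδt : 4 * (t : ℝ) ≤ δ ^ 2) {w : ℂ} (hw : 0 < w.im) (hfar : M + 2 * δ ≤ ‖w - c‖) :
    ∀ u ∈ Icc (0 : ℝ) t, δ ≤ ‖bwd W t w u - W (((t : ℝ) - u).toNNReal)‖ := by
  intro u hu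
  have key := le_norm_sub_of_far_aux (f := bwd W t w)
    (V := fun s ↦ (W (((t : ℝ) - s).toNNReal) : ℂ))
    (f' := fun s ↦ -vectorField W ((t : ℝ) - s) (bwd W t w s)) (b := t) (c := c) (M := M)
    (δ := δ) (continuousOn_bwd hW t hw) ?_ ?_ ?_ ?_ hδ hδt (by rwa [bwd_zero hW t hw]) u hu
  · exact key.1
  · exact (Complex.continuous_ofReal.comp (hW.comp (continuous_real_toNNReal.comp
      (continuous_const.sub continuous_id)))).continuousOn
  · intro s hs
    exact hasDerivWithinAt_Ici_of_backward (hasDerivWithinAt_bwd hW t hw) hs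
  · intro s _
    rw [norm_neg, vectorField_apply, norm_div, RCLike.norm_ofNat]
  · intro s hs
    exact hM ((t : ℝ) - s) ⟨by linarith [hs.2], by linarith [hs.1]⟩

/-- **`fₜ` is Lipschitz on the far field** (the quantitative form of "`fₜ(z) - z → 0` as
`z → ∞`" used for Rohde–Schramm's (5.1)): if `|W u - c| ≤ M` on `[0, t]`, `δ > 0`, `4t ≤ δ²`,
then for `w, w' ∈ ℍₒ` with `|w - c|, |w' - c| ≥ M + 2δ`,
`|fₜ w - fₜ w'| ≤ e^{2t/δ²} |w - w'|` — Grönwall for the backward flow, whose field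
`-2/(z - W)` is `2/δ²`-Lipschitz `δ`-away from the driver. Lawler (2005), proof of Thm 4.6,
eq. (4.7). [cite: Lawler2005, Thm 4.6 (eq. (4.7))] -/
theorem dist_loewnerInv_le_of_far (hW : Continuous W) {t : ℝ≥0} {c : ℂ} {M δ : ℝ}
    (hM : ∀ u ∈ Icc (0 : ℝ) t, ‖(W u.toNNReal : ℂ) - c‖ ≤ M) (hδ : 0 < δ)
    (hδt : 4 * (t : ℝ) ≤ δ ^ 2) {w w' : ℂ} (hw : 0 < w.im) (hw' : 0 < w'.im)
    (hfar : M + 2 * δ ≤ ‖w - c‖) (hfar' : M + 2 * δ ≤ ‖w' - c‖) :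
    dist (loewnerInv W t w) (loewnerInv W t w') ≤ dist w w' * Real.exp (2 / δ ^ 2 * t) := by
  set δn : ℝ≥0 := ⟨δ, hδ.le⟩ with hδn
  have hδn0 : 0 < δn := hδ
  have hLip : ∀ u ∈ Ico (0 : ℝ) t, LipschitzOnWith (2 / δn ^ 2)
      (fun z ↦ -vectorField W ((t : ℝ) - u) z)
      {z : ℂ | δ ≤ ‖z - W (((t : ℝ) - u).toNNReal)‖} := by
    intro u _
    have h := lipschitzOnWith_vectorField W ((t : ℝ) - u) hδn0
    rw [lipschitzOnWith_iff_norm_sub_le] at h ⊢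
    intro z hz z' hz'
    have := h hz hz'
    rwa [neg_sub_neg, norm_sub_rev]
  have key := dist_le_of_trajectories_ODE_of_mem
    (v := fun u z ↦ -vectorField W ((t : ℝ) - u) z)
    (s := fun u ↦ {z : ℂ | δ ≤ ‖z - W (((t : ℝ) - u).toNNReal)‖}) (K := 2 / δn ^ 2)
    (δ := dist w w') (f := bwd W t w) (g := bwd W t w') (a := 0) (b := t)
    hLip (continuousOn_bwd hW t hw)
    (fun u hu ↦ hasDerivWithinAt_Ici_of_backward (hasDerivWithinAt_bwd hW t hw) hu)
    (fun u hu ↦ le_norm_bwd_sub_driving_of_far hW hM hδ hδt hw hfar u ⟨hu.1, hu.2.le⟩)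
    (continuousOn_bwd hW t hw')
    (fun u hu ↦ hasDerivWithinAt_Ici_of_backward (hasDerivWithinAt_bwd hW t hw') hu)
    (fun u hu ↦ le_norm_bwd_sub_driving_of_far hW hM hδ hδt hw' hfar' u ⟨hu.1, hu.2.le⟩)
    (by rw [bwd_zero hW t hw, bwd_zero hW t hw'])
  have h := key t ⟨t.coe_nonneg, le_rfl⟩
  rw [bwd_self hW t hw, bwd_self hW t hw', sub_zero] at h
  have hK : ((2 / δn ^ 2 : ℝ≥0) : ℝ) = 2 / δ ^ 2 := by
    simp only [NNReal.coe_div, NNReal.coe_pow, NNReal.coe_ofNat, hδn]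
    rfl
  rwa [hK] at h

/-! ### `T ∘ fₜ ∘ T⁻¹` is Hölder continuous on the disc -/

/-- **Rohde–Schramm's (5.1) ⇒ "`T ∘ fₜ ∘ T⁻¹` is Hölder continuous in `𝕌`"** (proof of Cor. 5.3),
deterministic form: if `fₜ = gₜ⁻¹` is Hölder continuous with exponent `h ∈ (0, 1]` on every
bounded subset of `ℍₒ` (continuous driving function), then `w ↦ T (fₜ (T⁻¹ w))` is Hölder
continuous with exponent `h` on the unit disc, `T(z) = (z - i)/(z + i)`. Far field by
`dist_loewnerInv_le_of_far`, bounded part by hypothesis, mixed pairs by boundedness.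
[cite: RohdeSchramm2005, Cor 5.3 (proof, display (5.1); arXiv Cor 12)] -/
theorem exists_holderOnWith_cayley_conj_loewnerInv (hW : Continuous W) (t : ℝ≥0) {h : ℝ≥0}
    (hh : 0 < h) (hh1 : h ≤ 1)
    (hHol : ∀ R : ℝ, ∃ C : ℝ≥0,
      HolderOnWith C h (loewnerInv W t) (upperHalfPlaneSet ∩ closedBall 0 R)) :
    ∃ C : ℝ≥0,
      HolderOnWith C h (fun w ↦ cayleyFun (loewnerInv W t (cayleyInvFun w))) (ball 0 1) := by
  have hhr : (0 : ℝ) < h := hh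
  have hhr1 : (h : ℝ) ≤ 1 := hh1
  -- the far-field radius `R₀` and Lipschitz constant `L`
  obtain ⟨M, hM0, hM⟩ := exists_forall_norm_driving_sub_le hW t 0
  obtain ⟨δ, hδ, hδt, hδ1⟩ := exists_delta t one_pos
  set R₀ : ℝ := M + 2 * δ + 2 with hR₀
  have hR₀2 : 2 ≤ R₀ := by rw [hR₀]; linarith
  set L : ℝ := Real.exp (2 / δ ^ 2 * t) with hL
  have hL0 : 0 < L := Real.exp_pos _
  set ρ : ℝ := 2 / (R₀ + 1) with hρ
  have hρ0 : 0 < ρ := by positivity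
  have hρR : 2 / ρ = R₀ + 1 := by
    rw [hρ, div_div_eq_mul_div]
    field_simp
  set R₁ : ℝ := 2 * R₀ + 3 with hR₁
  obtain ⟨C₁, hC₁⟩ := hHol R₁
  set f := loewnerInv W t with hf
  -- points of the disc
  have hzim : ∀ w ∈ ball (0 : ℂ) 1, 0 < (cayleyInvFun w).im := fun w hw ↦
    cayleyInvFun_im_pos (mem_ball_zero_iff.1 hw)
  have hw1 : ∀ w ∈ ball (0 : ℂ) 1, w ≠ 1 := by
    rintro w hw rfl
    simp at hw
  have hzI : ∀ w ∈ ball (0 : ℂ) 1, cayleyInvFun w + I ≠ 0 := fun w hw ↦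
    add_I_ne_zero (hzim w hw).le
  have hcz : ∀ w ∈ ball (0 : ℂ) 1, cayleyFun (cayleyInvFun w) = w := fun w hw ↦
    cayleyFun_cayleyInvFun (hw1 w hw)
  have h1w : ∀ w ∈ ball (0 : ℂ) 1, ‖1 - w‖ = 2 / ‖cayleyInvFun w + I‖ := fun w hw ↦ by
    conv_lhs => rw [← hcz w hw]
    exact norm_one_sub_cayleyFun (hzI w hw)
  have hzIpos : ∀ w ∈ ball (0 : ℂ) 1, 0 < ‖cayleyInvFun w + I‖ := fun w hw ↦
    norm_pos_iff.2 (hzI w hw)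
  have hfim : ∀ w ∈ ball (0 : ℂ) 1, 0 < (f (cayleyInvFun w)).im := fun w hw ↦
    im_loewnerInv_pos hW t (hzim w hw)
  have hfI : ∀ w ∈ ball (0 : ℂ) 1, f (cayleyInvFun w) + I ≠ 0 := fun w hw ↦
    add_I_ne_zero (hfim w hw).le
  have hfI1 : ∀ w ∈ ball (0 : ℂ) 1, 1 ≤ ‖f (cayleyInvFun w) + I‖ := fun w hw ↦ by
    have h1 : (f (cayleyInvFun w) + I).im ≤ ‖f (cayleyInvFun w) + I‖ := Complex.im_le_norm _
    rw [add_im, I_im] at h1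
    linarith [hfim w hw]
  -- the two distance formulas
  have hdw : ∀ w ∈ ball (0 : ℂ) 1, ∀ w' ∈ ball (0 : ℂ) 1,
      ‖w - w'‖ = 2 * ‖cayleyInvFun w - cayleyInvFun w'‖ /
        (‖cayleyInvFun w + I‖ * ‖cayleyInvFun w' + I‖) := by
    intro w hw w' hw'
    conv_lhs => rw [← hcz w hw, ← hcz w' hw']
    exact norm_cayleyFun_sub_cayleyFun_of_ne (hzI w hw) (hzI w' hw')
  have hdΦ : ∀ w ∈ ball (0 : ℂ) 1, ∀ w' ∈ ball (0 : ℂ) 1,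
      ‖cayleyFun (f (cayleyInvFun w)) - cayleyFun (f (cayleyInvFun w'))‖ =
        2 * ‖f (cayleyInvFun w) - f (cayleyInvFun w')‖ /
          (‖f (cayleyInvFun w) + I‖ * ‖f (cayleyInvFun w') + I‖) :=
    fun w hw w' hw' ↦ norm_cayleyFun_sub_cayleyFun_of_ne (hfI w hw) (hfI w' hw')
  have hΦ1 : ∀ w ∈ ball (0 : ℂ) 1, ‖cayleyFun (f (cayleyInvFun w))‖ ≤ 1 := fun w hw ↦
    norm_cayleyFun_le_one (hfim w hw).le
  have hww2 : ∀ w ∈ ball (0 : ℂ) 1, ∀ w' ∈ ball (0 : ℂ) 1, ‖w - w'‖ ≤ 2 := by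
    intro w hw w' hw'
    have := norm_sub_le w w'
    have h1 := mem_ball_zero_iff.1 hw
    have h2 := mem_ball_zero_iff.1 hw'
    linarith
  have hpow2 : ∀ w ∈ ball (0 : ℂ) 1, ∀ w' ∈ ball (0 : ℂ) 1, ‖w - w'‖ ≤ 2 * ‖w - w'‖ ^ (h : ℝ) :=
    fun w hw w' hw' ↦ le_two_mul_rpow (norm_nonneg _) (hww2 w hw w' hw') hhr hhr1
  -- FAR points: `‖1 - w‖ ≤ ρ`
  have hfar_z : ∀ w ∈ ball (0 : ℂ) 1, ‖1 - w‖ ≤ ρ →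
      M + 2 * δ ≤ ‖cayleyInvFun w - 0‖ ∧ 2 ≤ ‖cayleyInvFun w + I‖ := by
    intro w hw hwρ
    have hzI' : R₀ + 1 ≤ ‖cayleyInvFun w + I‖ := by
      rw [← hρR, h1w w hw] at *
      rw [div_le_iff₀ (hzIpos w hw)] at hwρ
      rw [div_le_iff₀ hρ0]
      linarith
    have hz : R₀ ≤ ‖cayleyInvFun w‖ := by
      have := norm_add_le (cayleyInvFun w) I
      rw [Complex.norm_I] at this
      linarith
    refine ⟨?_, by linarith⟩
    rw [sub_zero]
    linarith
  have hfar_move : ∀ w ∈ ball (0 : ℂ) 1, ‖1 - w‖ ≤ ρ →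
      ‖f (cayleyInvFun w) - cayleyInvFun w‖ < 1 := fun w hw hwρ ↦
    (norm_invFunOn_map_sub_self_le hW hM hδ hδt (hzim w hw) (hfar_z w hw hwρ).1).trans_lt hδ1
  have hfar_den : ∀ w ∈ ball (0 : ℂ) 1, ‖1 - w‖ ≤ ρ →
      ‖cayleyInvFun w + I‖ / 2 ≤ ‖f (cayleyInvFun w) + I‖ := by
    intro w hw hwρ
    have h1 := hfar_move w hw hwρ
    have h2 := (hfar_z w hw hwρ).2
    have h3 : ‖cayleyInvFun w + I‖ ≤
        ‖f (cayleyInvFun w) + I‖ + ‖f (cayleyInvFun w) - cayleyInvFun w‖ := by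
      have := norm_sub_le (f (cayleyInvFun w) + I) (f (cayleyInvFun w) - cayleyInvFun w)
      rwa [show f (cayleyInvFun w) + I - (f (cayleyInvFun w) - cayleyInvFun w) =
        cayleyInvFun w + I by ring] at this
    linarith
  have hfar : ∀ w ∈ ball (0 : ℂ) 1, ∀ w' ∈ ball (0 : ℂ) 1, ‖1 - w‖ ≤ ρ → ‖1 - w'‖ ≤ ρ →
      ‖cayleyFun (f (cayleyInvFun w)) - cayleyFun (f (cayleyInvFun w'))‖ ≤
        8 * L * ‖w - w'‖ ^ (h : ℝ) := by
    intro w hw w' hw' hwρ hw'ρ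
    have hLip : ‖f (cayleyInvFun w) - f (cayleyInvFun w')‖ ≤
        L * ‖cayleyInvFun w - cayleyInvFun w'‖ := by
      have := dist_loewnerInv_le_of_far hW hM hδ hδt (hzim w hw) (hzim w' hw')
        (hfar_z w hw hwρ).1 (hfar_z w' hw' hw'ρ).1
      rw [dist_eq_norm, dist_eq_norm] at this
      linarith [mul_comm L ‖cayleyInvFun w - cayleyInvFun w'‖]
    have hd1 := hfar_den w hw hwρ
    have hd2 := hfar_den w' hw' hw'ρ
    have hp1 := hzIpos w hw
    have hp2 := hzIpos w' hw'
    have hp1' := hp1.ne'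
    have hp2' := hp2.ne'
    calc ‖cayleyFun (f (cayleyInvFun w)) - cayleyFun (f (cayleyInvFun w'))‖
        = 2 * ‖f (cayleyInvFun w) - f (cayleyInvFun w')‖ /
            (‖f (cayleyInvFun w) + I‖ * ‖f (cayleyInvFun w') + I‖) := hdΦ w hw w' hw'
      _ ≤ 2 * (L * ‖cayleyInvFun w - cayleyInvFun w'‖) /
            (‖cayleyInvFun w + I‖ / 2 * (‖cayleyInvFun w' + I‖ / 2)) := by
          apply div_le_div₀ (by positivity) (by linarith) (by positivity)
          exact mul_le_mul hd1 hd2 (by positivity) (norm_nonneg _)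
      _ = 4 * L * (2 * ‖cayleyInvFun w - cayleyInvFun w'‖ /
            (‖cayleyInvFun w + I‖ * ‖cayleyInvFun w' + I‖)) := by
          field_simp
          ring
      _ = 4 * L * ‖w - w'‖ := by rw [← hdw w hw w' hw']
      _ ≤ 4 * L * (2 * ‖w - w'‖ ^ (h : ℝ)) :=
          mul_le_mul_of_nonneg_left (hpow2 w hw w' hw') (by positivity)
      _ = 8 * L * ‖w - w'‖ ^ (h : ℝ) := by ring
  -- NEAR points: `ρ / 2 ≤ ‖1 - w‖`
  have hnear_z : ∀ w ∈ ball (0 : ℂ) 1, ρ / 2 ≤ ‖1 - w‖ →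
      ‖cayleyInvFun w + I‖ ≤ 2 * (R₀ + 1) ∧
        cayleyInvFun w ∈ upperHalfPlaneSet ∩ closedBall (0 : ℂ) R₁ := by
    intro w hw hwρ
    have hzI' : ‖cayleyInvFun w + I‖ ≤ 2 * (R₀ + 1) := by
      rw [h1w w hw, le_div_iff₀ (hzIpos w hw)] at hwρ
      rw [← hρR]
      rw [show 2 * (2 / ρ) = 2 / (ρ / 2) by ring, le_div_iff₀ (by positivity)]
      linarith
    refine ⟨hzI', hzim w hw, ?_⟩
    rw [mem_closedBall_zero_iff]
    have := norm_sub_le (cayleyInvFun w + I) I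
    rw [add_sub_cancel_right, Complex.norm_I] at this
    rw [hR₁]
    linarith
  have hnear : ∀ w ∈ ball (0 : ℂ) 1, ∀ w' ∈ ball (0 : ℂ) 1, ρ / 2 ≤ ‖1 - w‖ →
      ρ / 2 ≤ ‖1 - w'‖ →
      ‖cayleyFun (f (cayleyInvFun w)) - cayleyFun (f (cayleyInvFun w'))‖ ≤
        4 * C₁ * (R₀ + 1) ^ 2 * ‖w - w'‖ ^ (h : ℝ) := by
    intro w hw w' hw' hwρ hw'ρ
    obtain ⟨hb1, hmem1⟩ := hnear_z w hw hwρ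
    obtain ⟨hb2, hmem2⟩ := hnear_z w' hw' hw'ρ
    have hHo : ‖f (cayleyInvFun w) - f (cayleyInvFun w')‖ ≤
        C₁ * ‖cayleyInvFun w - cayleyInvFun w'‖ ^ (h : ℝ) := by
      have := hC₁.dist_le hmem1 hmem2
      rwa [dist_eq_norm, dist_eq_norm] at this
    have hzz : ‖cayleyInvFun w - cayleyInvFun w'‖ ≤ 2 * (R₀ + 1) ^ 2 * ‖w - w'‖ := by
      rw [hdw w hw w' hw', mul_div_assoc]
      rw [show 2 * (R₀ + 1) ^ 2 * (2 * (‖cayleyInvFun w - cayleyInvFun w'‖ /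
          (‖cayleyInvFun w + I‖ * ‖cayleyInvFun w' + I‖))) =
        ‖cayleyInvFun w - cayleyInvFun w'‖ * ((2 * (R₀ + 1)) * (2 * (R₀ + 1)) /
          (‖cayleyInvFun w + I‖ * ‖cayleyInvFun w' + I‖)) by ring]
      apply le_mul_of_one_le_right (norm_nonneg _)
      rw [one_le_div (mul_pos (hzIpos w hw) (hzIpos w' hw'))]
      exact mul_le_mul hb1 hb2 (norm_nonneg _) (by positivity)
    have hK1 : 1 ≤ 2 * (R₀ + 1) ^ 2 := by nlinarith
    have hpow : ‖cayleyInvFun w - cayleyInvFun w'‖ ^ (h : ℝ) ≤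
        2 * (R₀ + 1) ^ 2 * ‖w - w'‖ ^ (h : ℝ) :=
      calc ‖cayleyInvFun w - cayleyInvFun w'‖ ^ (h : ℝ)
          ≤ (2 * (R₀ + 1) ^ 2 * ‖w - w'‖) ^ (h : ℝ) :=
            Real.rpow_le_rpow (norm_nonneg _) hzz hhr.le
        _ = (2 * (R₀ + 1) ^ 2) ^ (h : ℝ) * ‖w - w'‖ ^ (h : ℝ) :=
            Real.mul_rpow (by positivity) (norm_nonneg _)
        _ ≤ 2 * (R₀ + 1) ^ 2 * ‖w - w'‖ ^ (h : ℝ) :=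
            mul_le_mul_of_nonneg_right (Real.rpow_le_self_of_one_le hK1 hhr1)
              (Real.rpow_nonneg (norm_nonneg _) _)
    have hden : 1 ≤ ‖f (cayleyInvFun w) + I‖ * ‖f (cayleyInvFun w') + I‖ :=
      one_le_mul_of_one_le_of_one_le (hfI1 w hw) (hfI1 w' hw')
    calc ‖cayleyFun (f (cayleyInvFun w)) - cayleyFun (f (cayleyInvFun w'))‖
        = 2 * ‖f (cayleyInvFun w) - f (cayleyInvFun w')‖ /
            (‖f (cayleyInvFun w) + I‖ * ‖f (cayleyInvFun w') + I‖) := hdΦ w hw w' hw'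
      _ ≤ 2 * ‖f (cayleyInvFun w) - f (cayleyInvFun w')‖ := div_le_self (by positivity) hden
      _ ≤ 2 * (C₁ * (2 * (R₀ + 1) ^ 2 * ‖w - w'‖ ^ (h : ℝ))) := by
          have := hHo.trans (mul_le_mul_of_nonneg_left hpow C₁.coe_nonneg)
          linarith
      _ = 4 * C₁ * (R₀ + 1) ^ 2 * ‖w - w'‖ ^ (h : ℝ) := by ring
  -- MIXED pairs are `ρ/2`-separated
  have hmixed : ∀ w ∈ ball (0 : ℂ) 1, ∀ w' ∈ ball (0 : ℂ) 1, ρ / 2 < ‖w - w'‖ →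
      ‖cayleyFun (f (cayleyInvFun w)) - cayleyFun (f (cayleyInvFun w'))‖ ≤
        8 / ρ * ‖w - w'‖ ^ (h : ℝ) := by
    intro w hw w' hw' hsep
    have h2 : ‖cayleyFun (f (cayleyInvFun w)) - cayleyFun (f (cayleyInvFun w'))‖ ≤ 2 := by
      have := norm_sub_le (cayleyFun (f (cayleyInvFun w))) (cayleyFun (f (cayleyInvFun w')))
      linarith [hΦ1 w hw, hΦ1 w' hw']
    have h3 : (2 : ℝ) ≤ 4 / ρ * ‖w - w'‖ := by
      rw [div_mul_eq_mul_div, le_div_iff₀ hρ0]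
      linarith
    calc ‖cayleyFun (f (cayleyInvFun w)) - cayleyFun (f (cayleyInvFun w'))‖ ≤ 2 := h2
      _ ≤ 4 / ρ * ‖w - w'‖ := h3
      _ ≤ 4 / ρ * (2 * ‖w - w'‖ ^ (h : ℝ)) :=
          mul_le_mul_of_nonneg_left (hpow2 w hw w' hw') (by positivity)
      _ = 8 / ρ * ‖w - w'‖ ^ (h : ℝ) := by ring
  -- assemble
  set C : ℝ := max (8 * L) (max (4 * C₁ * (R₀ + 1) ^ 2) (8 / ρ)) with hC
  have hC0 : 0 ≤ C := le_max_of_le_left (by positivity)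
  refine ⟨C.toNNReal, holderOnWith_of_dist_le hC0 fun w hw w' hw' ↦ ?_⟩
  rw [dist_eq_norm, dist_eq_norm]
  have hx0 : 0 ≤ ‖w - w'‖ ^ (h : ℝ) := Real.rpow_nonneg (norm_nonneg _) _
  by_cases hA : ‖1 - w‖ ≤ ρ ∧ ‖1 - w'‖ ≤ ρ
  · exact (hfar w hw w' hw' hA.1 hA.2).trans (mul_le_mul_of_nonneg_right (le_max_left _ _) hx0)
  by_cases hB : ρ / 2 ≤ ‖1 - w‖ ∧ ρ / 2 ≤ ‖1 - w'‖
  · exact (hnear w hw w' hw' hB.1 hB.2).trans (mul_le_mul_of_nonneg_right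
      ((le_max_left _ _).trans (le_max_right _ _)) hx0)
  · have hsep : ρ / 2 < ‖w - w'‖ := by
      rw [not_and_or, not_le, not_le] at hA hB
      have htri : ‖1 - w'‖ ≤ ‖1 - w‖ + ‖w - w'‖ := norm_sub_le_norm_sub_add_norm_sub 1 w w'
      have htri' : ‖1 - w‖ ≤ ‖1 - w'‖ + ‖w - w'‖ := by
        have := norm_sub_le_norm_sub_add_norm_sub 1 w' w
        rwa [norm_sub_rev w' w] at this
      rcases hB with hB | hB
      · rcases hA with hA | hA <;> linarith
      · rcases hA with hA | hA <;> linarith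
    exact (hmixed w hw w' hw' hsep).trans (mul_le_mul_of_nonneg_right
      ((le_max_right _ _).trans (le_max_right _ _)) hx0)

/-- **The Cayley image of a Loewner domain is a Hölder domain as soon as `fₜ` is Hölder on
bounded sets** (Rohde–Schramm 2005, proof of Cor. 5.3 from (5.1)): for a continuous driving
function `W`, if `fₜ = gₜ⁻¹` is Hölder continuous with exponent `h > 0` on every bounded subset
of `ℍₒ`, then `T(Hₜ)` is a Hölder domain, `T ∘ fₜ ∘ T⁻¹ : 𝔻 → T(Hₜ)` being a conformal
equivalence Hölder continuous (exponent `min h 1`) on `𝔻`.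
[cite: RohdeSchramm2005, Cor 5.3 (proof, display (5.1); arXiv Cor 12)] -/
theorem isHolderDomain_image_cayleyFun_domain (hW : Continuous W) (t : ℝ≥0) {h : ℝ≥0}
    (hh : 0 < h)
    (hHol : ∀ R : ℝ, ∃ C : ℝ≥0,
      HolderOnWith C h (loewnerInv W t) (upperHalfPlaneSet ∩ closedBall 0 R)) :
    IsHolderDomain (cayleyFun '' domain W t) := by
  -- lower the exponent to `h' = min h 1`
  set h' : ℝ≥0 := min h 1 with hh'
  have hh'0 : 0 < h' := lt_min hh one_pos
  have hh'1 : h' ≤ 1 := min_le_right _ _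
  have hHol' : ∀ R : ℝ, ∃ C : ℝ≥0,
      HolderOnWith C h' (loewnerInv W t) (upperHalfPlaneSet ∩ closedBall 0 R) := fun R ↦
    HolderOnWith.exists_holderOnWith_of_le (hHol R) (min_le_left _ _)
      (isBounded_closedBall.subset inter_subset_right)
  obtain ⟨C, hC⟩ := exists_holderOnWith_cayley_conj_loewnerInv hW t hh'0 hh'1 hHol'
  obtain ⟨ψ, hψ, -⟩ := exists_conformalEquiv_image_cayleyFun (domain_subset W t)
  refine ⟨cayley.symm.trans ((conformalEquivMap hW t).symm.trans ψ), C, h', hh'0, ?_⟩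
  have happly : ∀ w, (cayley.symm.trans ((conformalEquivMap hW t).symm.trans ψ)) w =
      cayleyFun (loewnerInv W t (cayleyInvFun w)) := fun w ↦ by
    rw [ConformalEquiv.trans_apply, ConformalEquiv.trans_apply, cayley_symm_apply,
      conformalEquivMap_symm_apply, hψ]
  intro w hw w' hw'
  rw [happly, happly]
  exact hC w hw w' hw'

end Loewner

/-! ### The named fact from Theorem 5.2 -/

/-- **Rohde–Schramm 2005, Thm 5.2 ⇒ the Cayley image of `Hₜ` is a.s. a Hölder domain**
(the passage "(5.1) … By (5.1), `T ∘ fₜ ∘ T⁻¹` is a.s. Hölder continuous in `𝕌`" of the proof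
of Cor. 5.3): `RohdeSchramm2005_thm52 → RohdeSchramm2005_isHolderDomain_cayley_domain`. The
full-measure event is the intersection over `n ∈ ℕ` of the events of Thm 5.2 for the bounded
sets `ℍₒ ∩ B̄(0, n)`; on it `fₜ(z) = f̂ₜ(z - W t)` is Hölder on every bounded set and
`Loewner.isHolderDomain_image_cayleyFun_domain` applies.
[cite: RohdeSchramm2005, Cor 5.3 (proof, display (5.1); arXiv Cor 12)] -/
theorem RohdeSchramm2005_isHolderDomain_cayley_domain_of_thm52 (h52 : RohdeSchramm2005_thm52) :
    RohdeSchramm2005_isHolderDomain_cayley_domain := by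
  intro κ hκ h4 t ht
  obtain ⟨h, hh, hA⟩ := h52 κ hκ h4
  have hn : ∀ n : ℕ, ∀ᵐ ω ∂Process.preWienerMeasure, ∃ C : ℝ≥0,
      HolderOnWith C h (Loewner.fHat (sleDriving κ ω) t)
        (upperHalfPlaneSet ∩ closedBall (0 : ℂ) n) := fun n ↦
    hA _ (isBounded_closedBall.subset inter_subset_right) inter_subset_left t ht
  filter_upwards [ae_all_iff.2 hn] with ω hω
  set W := sleDriving κ ω with hW
  refine Loewner.isHolderDomain_image_cayleyFun_domain (continuous_sleDriving κ ω) t hh fun R ↦ ?_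
  obtain ⟨n, hn⟩ := exists_nat_ge (R + |W t|)
  obtain ⟨C, hC⟩ := hω n
  refine ⟨C, fun z hz z' hz' ↦ ?_⟩
  have hmem : ∀ {z : ℂ}, z ∈ upperHalfPlaneSet ∩ closedBall (0 : ℂ) R →
      z - (W t : ℂ) ∈ upperHalfPlaneSet ∩ closedBall (0 : ℂ) n := by
    intro z hz
    refine ⟨?_, ?_⟩
    · show 0 < (z - (W t : ℂ)).im
      rw [sub_im, ofReal_im, sub_zero]
      exact hz.1
    · rw [mem_closedBall_zero_iff]
      calc ‖z - (W t : ℂ)‖ ≤ ‖z‖ + ‖(W t : ℂ)‖ := norm_sub_le _ _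
        _ ≤ R + |W t| := add_le_add (mem_closedBall_zero_iff.1 hz.2)
            (by rw [Complex.norm_real, Real.norm_eq_abs])
        _ ≤ n := hn
  have key := hC (z - W t) (hmem hz) (z' - W t) (hmem hz')
  rw [Loewner.fHat_apply, Loewner.fHat_apply, add_sub_cancel, add_sub_cancel,
    edist_sub_right] at key
  exact key

/-- **The named fact holds**: for `κ ≠ 4` (and `κ ≠ 0`) and every `t > 0`, almost surely the
Cayley image `T(Hₜ)` of the SLE_κ Loewner domain `Hₜ = ℍₒ ∖ Kₜ` is a Hölder domain — Rohde–Schramm's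
Theorem 5.2 (`RohdeSchramm2005_thm52_holds`, `SLEHolderContinuity.lean`) fed into the proved
passage "(5.1) … `T ∘ fₜ ∘ T⁻¹` is a.s. Hölder continuous in `𝕌`" of the proof of Cor. 5.3
(`RohdeSchramm2005_isHolderDomain_cayley_domain_of_thm52`).
[cite: RohdeSchramm2005, Cor 5.3 (proof, display (5.1); arXiv Cor 12)] -/
theorem RohdeSchramm2005_isHolderDomain_cayley_domain_holds :
    RohdeSchramm2005_isHolderDomain_cayley_domain :=
  RohdeSchramm2005_isHolderDomain_cayley_domain_of_thm52 RohdeSchramm2005_thm52_holds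

end Literature.Probability.RandomPlanarGeometry
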